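import Summits.ResolutionOfSingularities.ResolutionOfSingularities.Theorems.EquisingularLiftEquisingularLiftNatTowerPtRamMember
import Summits.ResolutionOfSingularities.ResolutionOfSingularities.Theorems.EquisingularLiftEquisingularLiftNatTowerPtRamInv
import Summits.ResolutionOfSingularities.ResolutionOfSingularities.Theorems.EquisingularLiftEquisingularLiftNatDirZeroDefs
import HarnessLib

/-!
# [OURS · L1 W4.5(b) · EL♮(3) · WIDTH TABLE W₂, engine bullet (P-ram)] THE RAMIFIED POINT STEP AT A PREFIX POINT, AT STAGE LEVEL:
# the ISO-prefix port of the nose engine's B₄ bullet ✓ `fatPointStep_model` — hostless, no letters, no tag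

res-L1-w45b-stub-2 g19 (STUB WORKER 2; desk approval of the (P-ram) split, cell bus 2026-08-29T07:54:25Z: «stub-2 takes the (P-ram) bullet as the standalone helper
`…NatPrefixPtRamStep`, stub-4 keeps K5⁹ + (HR-SEC) and CALLS it»).  OURS; NOT a statement of any manuscript ([Hironaka2017] is a candidate under adjudication —
nothing of it is asserted here); AI-written, weaker than expert review.  No `sorry`; standard axioms; DEF-FREE; `--supports stmt-ResolutionOfSingularities-20148
--as helper`, counted 0.  EL♮(3) is NOT proved; resolution in positive characteristic is NOT proved anywhere in this tree.

WHAT.  In the binders of the lettered-prefix T-ISO engines (✓ K5⁸ `target_elnat_of_letteredPrefixResolution8`: the fixed ambient `P` over the DVR `O` with residue map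
`θ : O ↠ k`, the stage predicate `Ch` with `hChain`/`hStep`, the current stage `(X', σ', S')` — integral, dominant — and its MODEL SQUARE `j : F → X'` over `Spec θ`
with `j '' T = S'`, `T` closed), and the letters of the door clause (P-ram) of `PrefixReachKeyLetterParam9` (res-type-027, W₂; `Fin 3` there = `Fin n` here at the
door's `n = 3`): a closed NON-REGULAR point `y` of `T̃ = redSub (closure T)`, an ideal sheaf `J` supported at `curvePt F T y` and generated in the stalk by `n` elements
of `𝔪` independent in `𝔪/𝔪²` (a curvilinear fat point), and its blow-up `υ₂ : F₂ → F`: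
★ `prefix_ptRam_step` — the NEW MODEL SQUARE for the engine's invariant at `(F₂, υ₂ ≫ ρ, closure (υ₂⁻¹(T ∖ {pt})), [], none)`: `F₂` integral, the new running set
irreducible, a stage `(X'', τ ≫ σ', S'')` with `Ch`, integral, locally Noetherian, REGULAR, dominant, a model square `j₂ : F₂ → X''` over `Spec θ` with
`j₂ ≫ τ = υ₂ ≫ j` and `j₂ '' closure (υ₂⁻¹(T ∖ {pt})) = S''`.  ONE call of ✓ `fatPointStep_model` (res-L1-w45b-stub-4, …NatTowerPtRamMember), its three point
hypotheses supplied exactly as in ✓ `Tower.invB₄_ptRamStep` (✓ `subschemeι_mem_of_isClosed`, ✓ `not_subset_singleton_of_not_isRegularLocalRing_stalk`,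
✓ `not_isGenericPoint_of_image_eq`).  The door's extra letter «the AMBIENT is not regular at the point» is not read.
References (method / index only): Q. Liu, *Algebraic Geometry and Arithmetic Curves* (2002), §8.1, Thm. 8.1.19; The Stacks Project, Tag 0805.
-/

set_option linter.dupNamespace false -- mandated namespace `Summit.<Summit>.<Problem>` of this single-conjunct summit
set_option linter.overlappingInstances false -- the binders carry `[IsDomain O] [IsDiscreteValuationRing O]`

noncomputable section

open CategoryTheory CategoryTheory.Limits AlgebraicGeometry TopologicalSpace Topology IsLocalRing
open Literature.AlgebraicGeometry.Resolution
open AlgebraicGeometry.Scheme.IdealSheafData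
open Summit.ResolutionOfSingularities.ResolutionOfSingularities.Theses.EquisingularLift.Split
open Summit.ResolutionOfSingularities.ResolutionOfSingularities.Cruxes.EquisingularLift.StrataSplit

namespace Summit.ResolutionOfSingularities.ResolutionOfSingularities.Cruxes.EquisingularLiftNat.Sections

/-- ★ **THE (P-ram) ENGINE BULLET: the ramified point step at a prefix point, at stage level** — the new model square of the lettered-prefix invariant
after blowing up a curvilinear fat point at a closed non-regular point of `T̃`.  See the module docstring.
[cite: Liu2002, §8.1 and Thm. 8.1.19] [cite: StacksProject, Tag 0805] [OURS · L1 W4.5b · W₂ engine bullet (P-ram); counted 0] -/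
theorem prefix_ptRam_step (O : Type) [CommRing O] [IsDomain O] [IsDiscreteValuationRing O] [IsAdicComplete (maximalIdeal O) O]
    [IsAlgClosed (ResidueField O)] (k : Type) [Field k] (θ : O →+* k) (hθ : Function.Surjective θ)
    (P : Scheme.{0}) (q : P ⟶ Spec (.of O)) (Y : Set P) (hYsp : Y ⊆ q ⁻¹' {closedPoint O}) (hYirr : IsIrreducible Y)
    (hYcl : IsClosed Y) [IsProper q] [IsIntegral P] (hPnoeth : IsLocallyNoetherian P) (hPreg : Scheme.IsRegular P)
    (n : ℕ) [SmoothOfRelativeDimension n q]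
    (Ch : ∀ X' : Scheme.{0}, (X' ⟶ P) → Set X' → Prop)
    (hChain : ∀ (X' : Scheme.{0}) (σ : X' ⟶ P) (S : Set X'), Ch X' σ S → Chain P Y X' σ S)
    (hStep : ∀ (X' X'' : Scheme.{0}) (σ' : X' ⟶ P) (S' : Set X') (C : X'.IdealSheafData) (τ : X'' ⟶ X'),
      Ch X' σ' S' → IsBlowup τ C → Scheme.IsRegular C.subscheme → Flat (C.subschemeι ≫ σ' ≫ q) →
      σ' '' (C.support : Set X') ⊆ {x : P | ¬ IsGenericPoint x Y} →
      (C.support : Set X') ∩ (σ' ≫ q) ⁻¹' {closedPoint O} ⊆ S' →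
      Ch X'' (τ ≫ σ') (closure (τ ⁻¹' (S' \ (C.support : Set X')))))
    -- the current stage and its model square (the invariant's data)
    (X' : Scheme.{0}) (σ' : X' ⟶ P) (S' : Set X') (hCh : Ch X' σ' S') [IsIntegral X'] (hdom : IsDominant (σ' ≫ q))
    (F : Scheme.{0}) [IsIntegral F] (j : F ⟶ X') (t : F ⟶ Spec (.of k))
    (hsq : IsPullback j t (σ' ≫ q) (Spec.map (CommRingCat.ofHom θ)))
    (T : Set F) (hTcl : IsClosed T) (hTS : j '' T = S')
    -- the letters of (P-ram): a closed non-regular point of `T̃`, a curvilinear fat point there, its blow-up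
    (y : ↥(redSub F (closure T) isClosed_closure)) (J : F.IdealSheafData) (F₂ : Scheme.{0}) (υ₂ : F₂ ⟶ F)
    (hTreg : ¬ IsRegularLocalRing ((redSub F (closure T) isClosed_closure).presheaf.stalk y))
    (hJsupp : (J.support : Set F) = {curvePt F T y})
    (hJgen : ∃ (ℓ : Fin n → F.presheaf.stalk (curvePt F T y)) (hℓ : ∀ i, ℓ i ∈ maximalIdeal (F.presheaf.stalk (curvePt F T y))),
      stalkIdeal J (curvePt F T y) = Ideal.span (Set.range ℓ) ∧
      LinearIndependent (ResidueField (F.presheaf.stalk (curvePt F T y)))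
        (fun i => (maximalIdeal (F.presheaf.stalk (curvePt F T y))).toCotangent ⟨ℓ i, hℓ i⟩))
    (hυ₂ : IsBlowup υ₂ J) :
    IsIntegral F₂ ∧ IsLocallyNoetherian F₂ ∧ IsIrreducible (closure (υ₂ ⁻¹' (T \ {curvePt F T y}))) ∧
    ∃ (X'' : Scheme.{0}) (τ : X'' ⟶ X') (S'' : Set X'') (j₂ : F₂ ⟶ X'') (t₂ : F₂ ⟶ Spec (.of k)),
      Ch X'' (τ ≫ σ') S'' ∧ IsIntegral X'' ∧ IsLocallyNoetherian X'' ∧ Scheme.IsRegular X'' ∧ IsDominant ((τ ≫ σ') ≫ q) ∧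
      IsProper ((τ ≫ σ') ≫ q) ∧ IsPullback j₂ t₂ ((τ ≫ σ') ≫ q) (Spec.map (CommRingCat.ofHom θ)) ∧ j₂ ≫ τ = υ₂ ≫ j ∧
      j₂ '' closure (υ₂ ⁻¹' (T \ {curvePt F T y})) = S'' := by
  classical
  have hyT : curvePt F T y ∈ T := subschemeι_mem_of_isClosed hTcl y
  have hyc : IsClosed ({curvePt F T y} : Set F) := hJsupp ▸ J.support.isClosed
  have hTy : ¬ T ⊆ {curvePt F T y} := not_subset_singleton_of_not_isRegularLocalRing_stalk y hTreg hyc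
  haveI : IsClosedImmersion (Spec.map (CommRingCat.ofHom θ)) := IsClosedImmersion.spec_of_surjective _ hθ
  haveI hjci : IsClosedImmersion j := MorphismProperty.IsStableUnderBaseChange.of_isPullback hsq.flip inferInstance
  have hjyc : IsClosed ({j (curvePt F T y)} : Set X') := by
    simpa only [Set.image_singleton] using hjci.isClosedEmbedding.isClosedMap _ hyc
  have hyoff : ¬ IsGenericPoint (σ' (j (curvePt F T y))) Y :=
    not_isGenericPoint_of_image_eq (hChain _ _ _ hCh) j hjci.isClosedEmbedding.injective hTS hjyc hTy
  obtain ⟨ℓ, hℓ, hJℓ, hli⟩ := hJgen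
  obtain ⟨C, X'', τ, j₂, t₂, -, -, -, -, -, -, hCh'', hreg'', hnoeth'', hint'', hdom'', hprop'', -, -, hF₂int, hF₂noeth, hT'irr,
      hsq₂, hcomm, hsets⟩ :=
    fatPointStep_model O k θ hθ P q Y hYsp hYirr hYcl hPnoeth hPreg n Ch hChain hStep X' σ' S' hCh hdom F j t hsq T hTS
      (curvePt F T y) hyT hTy hyoff J hJsupp ℓ hℓ hJℓ hli F₂ υ₂ hυ₂
  exact ⟨hF₂int, hF₂noeth, hT'irr, X'', τ, _, j₂, t₂, hCh'', hint'', hnoeth'', hreg'', hdom'', hprop'', hsq₂, hcomm, hsets⟩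

end Summit.ResolutionOfSingularities.ResolutionOfSingularities.Cruxes.EquisingularLiftNat.Sections

end
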